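import Mathlib
import Summits.Schanuel.Schanuel.Theses.RigidCore
import Summits.Schanuel.Schanuel.Theorems.AclSubsetLogFreeCore.Negative.RealDefinableCalibration

/-!
# Crux `SchanuelOnLogFreeCore` (R), line `sector-split` — calibration C24: core Hermite–Lindemann ⟹ no logarithm of `π` lies in `C_EA`

Calibration C24 of line `sector-split` for the crux stmt-Schanuel-0970 `RigidCore.SchanuelOnLogFreeCore`
(R).  We prove `stub_logPi_of_coreHL`:

*if the log-free core `C_EA = logFreeCore` satisfies Hermite–Lindemann relative to the kernel — every
`u ∈ C_EA` with `eᵘ` algebraic over `ℚ(2πi, u)` lies on the kernel line `ℚ·2πi` — then no logarithm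
of `π` lies in `C_EA`: `eᵘ = π ⟹ u ∉ C_EA`.*

Proof: `π = 2πi · (2i)⁻¹` is algebraic over any intermediate field containing `2πi`, in particular over
`ℚ(2πi, u)` (`LogPiCoreHL.isAlgebraic_pi_of_two_pi_I_mem`); so for `u ∈ C_EA` with `eᵘ = π` the
hypothesis forces `u = q·2πi` with `q ∈ ℚ`, and then `|eᵘ| = 1 ≠ π`
(`LogPiCoreHL.exp_ne_pi_of_mem_span`).

The hypothesis is exactly the conclusion of the lead's stub C22 (`(R) ⟹` core Hermite–Lindemann);
composed with it in the lead's skeleton this file gives **(R) ⟹ no logarithm of `π` in `C_EA`**.  With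
(A) `RigidCore.AclSubsetLogFreeCore` and `Def_∅(ℝ)` the (A)-chain's landed
`AclSubsetLogFreeCore.Negative.log_pi_mem_logFreeCore_of_real_definable` puts `ln π ∈ C_EA`, so this
is a second route (after C21, via `ln 2`) to **(A) ∧ (R) ⟹ `ℝ` is not `∅`-definable in
`ℂ_exp = (ℂ, +, ·, exp)`** (`LogPiCoreHL.real_not_definable_of_coreHL_of_A`), an undefinability
statement that is open.

## References

* [KirbyMacintyreOnshuus2012] J. Kirby, A. Macintyre, A. Onshuus, *The algebraic numbers definable
  in various exponential fields*, J. Inst. Math. Jussieu 11 (2012) 825–834, arXiv:1101.4224, p. 2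
  (definability of `ℝ` in `ℂ_exp` is one of the "two main open questions").
-/

noncomputable section

set_option linter.dupNamespace false

open Summit.Schanuel.Schanuel.Theses
open Summit.Schanuel.Schanuel.Theorems.AclSubsetLogFreeCore.Negative

namespace Summit.Schanuel.Schanuel.Theorems.RigidCore

namespace LogPiCoreHL

/-- `|e^{q·2πi}| = 1` for rational `q` (the exponent is purely imaginary). [folklore] -/
theorem norm_exp_rat_smul_two_pi_I (q : ℚ) :
    ‖Complex.exp (q • (2 * ↑Real.pi * Complex.I : ℂ))‖ = 1 := by
  rw [Complex.norm_exp, Rat.smul_def]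
  simp

/-- No point of the kernel line `ℚ·2πi` is a logarithm of `π`: `|e^{q·2πi}| = 1 < 3 < π`. [folklore] -/
theorem exp_ne_pi_of_mem_span {u : ℂ}
    (hu : u ∈ Submodule.span ℚ ({(2 * ↑Real.pi * Complex.I : ℂ)} : Set ℂ)) :
    Complex.exp u ≠ ↑Real.pi := by
  obtain ⟨q, rfl⟩ := Submodule.mem_span_singleton.1 hu
  intro h
  have h1 := norm_exp_rat_smul_two_pi_I q
  rw [h, Complex.norm_of_nonneg Real.pi_pos.le] at h1
  linarith [Real.pi_gt_three]

/-- `π = 2πi · (2i)⁻¹` is algebraic over every intermediate field of `ℂ/ℚ` containing `2πi`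
(`i` is algebraic over `ℚ`: the tree's `Literature.Barriers.Schanuel.isAlgebraic_I`). [folklore] -/
theorem isAlgebraic_pi_of_two_pi_I_mem {K : IntermediateField ℚ ℂ}
    (hK : (2 * ↑Real.pi * Complex.I : ℂ) ∈ K) : IsAlgebraic K (Real.pi : ℂ) := by
  have hI : IsAlgebraic K Complex.I :=
    Literature.Barriers.Schanuel.isAlgebraic_I.tower_top (L := K)
  have h2 : IsAlgebraic K (2 : ℂ) := by
    exact_mod_cast isAlgebraic_nat (R := K) (A := ℂ) 2
  have h2piI : IsAlgebraic K (2 * ↑Real.pi * Complex.I : ℂ) :=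
    isAlgebraic_algebraMap (⟨_, hK⟩ : K)
  have hpi : (Real.pi : ℂ) = (2 * ↑Real.pi * Complex.I) * (2 * Complex.I)⁻¹ := by
    rw [eq_comm, mul_inv_eq_iff_eq_mul₀ (mul_ne_zero two_ne_zero Complex.I_ne_zero)]
    ring
  rw [hpi]
  exact h2piI.mul (h2.mul hI).inv

/-- **Core Hermite–Lindemann ⟹ no logarithm of `π` in `C_EA`** (pointed form of the stub): for
`u ∈ C_EA` with `eᵘ = π`, `eᵘ` is algebraic over `ℚ(2πi, u) ∋ 2πi`, so `u ∈ ℚ·2πi`, where `eᵘ = π`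
is impossible. [folklore] -/
theorem logPi_not_mem_core_of_coreHL
    (hHL : ∀ u : ℂ, u ∈ logFreeCore →
        IsAlgebraic (↥(IntermediateField.adjoin ℚ ({(2 * ↑Real.pi * Complex.I : ℂ), u} : Set ℂ)))
            (Complex.exp u) →
          u ∈ Submodule.span ℚ ({(2 * ↑Real.pi * Complex.I : ℂ)} : Set ℂ))
    {u : ℂ} (hlog : Complex.exp u = ↑Real.pi) : u ∉ logFreeCore := by
  intro hu
  have hmem : (2 * ↑Real.pi * Complex.I : ℂ) ∈
      IntermediateField.adjoin ℚ ({(2 * ↑Real.pi * Complex.I : ℂ), u} : Set ℂ) :=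
    IntermediateField.subset_adjoin ℚ _ (Set.mem_insert _ _)
  have halg : IsAlgebraic
      (↥(IntermediateField.adjoin ℚ ({(2 * ↑Real.pi * Complex.I : ℂ), u} : Set ℂ)))
      (Complex.exp u) := by
    rw [hlog]
    exact isAlgebraic_pi_of_two_pi_I_mem hmem
  exact exp_ne_pi_of_mem_span (hHL u hu halg) hlog

/-- Core Hermite–Lindemann ⟹ `ln π ∉ C_EA` (the real logarithm: `e^{ln π} = π`). [folklore] -/
theorem realLogPi_not_mem_core_of_coreHL
    (hHL : ∀ u : ℂ, u ∈ logFreeCore →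
        IsAlgebraic (↥(IntermediateField.adjoin ℚ ({(2 * ↑Real.pi * Complex.I : ℂ), u} : Set ℂ)))
            (Complex.exp u) →
          u ∈ Submodule.span ℚ ({(2 * ↑Real.pi * Complex.I : ℂ)} : Set ℂ)) :
    ((Real.log Real.pi : ℝ) : ℂ) ∉ logFreeCore :=
  logPi_not_mem_core_of_coreHL hHL (by rw [← Complex.ofReal_exp, Real.exp_log Real.pi_pos])

/-- **Core Hermite–Lindemann + (A) ⟹ `ℝ ⊆ ℂ` is not `∅`-definable in `ℂ_exp`** (second route, via
`ln π`): under (A) + `Def_∅(ℝ)` the (A)-chain's landed `log_pi_mem_logFreeCore_of_real_definable`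
gives `ln π ∈ C_EA`, contradicting `realLogPi_not_mem_core_of_coreHL`.  Composed with (R) ⟹ core HL
(C22) this is the parameter-free case of the undefinability of `ℝ` in `ℂ_exp`, which is open.
[cite: KirbyMacintyreOnshuus2012, p. 2] -/
theorem real_not_definable_of_coreHL_of_A
    (hHL : ∀ u : ℂ, u ∈ logFreeCore →
        IsAlgebraic (↥(IntermediateField.adjoin ℚ ({(2 * ↑Real.pi * Complex.I : ℂ), u} : Set ℂ)))
            (Complex.exp u) →
          u ∈ Submodule.span ℚ ({(2 * ↑Real.pi * Complex.I : ℂ)} : Set ℂ))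
    (hA : RigidCore.AclSubsetLogFreeCore) :
    ¬ Set.Definable₁ (∅ : Set ℂ) Literature.ModelTheory.ExponentialFields.Language.expRing
        (Set.range ((↑) : ℝ → ℂ)) := fun hdef =>
  realLogPi_not_mem_core_of_coreHL hHL (log_pi_mem_logFreeCore_of_real_definable hA hdef)

end LogPiCoreHL

/-- **C24 — core Hermite–Lindemann ⟹ no logarithm of `π` lies in the log-free core.**  If every
`u ∈ C_EA` with `eᵘ` algebraic over `ℚ(2πi, u)` lies on `ℚ·2πi` (the conclusion of the lead's C22,
`(R) ⟹` core Hermite–Lindemann), then `eᵘ = π ⟹ u ∉ C_EA`: `π = 2πi/(2i)` is algebraic over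
`ℚ(2πi, u)`, and on the kernel line `|e^{q·2πi}| = 1 ≠ π`.  With (A) + `Def_∅(ℝ)` the (A)-chain's
`log_pi_mem_logFreeCore_of_real_definable` puts `ln π ∈ C_EA`
(`LogPiCoreHL.real_not_definable_of_coreHL_of_A`): a second route to `(A) ∧ (R) ⟹ ¬Def_∅(ℝ)`
(open; KMO arXiv:1101.4224, p. 2). [cite: KirbyMacintyreOnshuus2012, p. 2] -/
theorem stub_logPi_of_coreHL :
    (∀ u : ℂ, u ∈ logFreeCore →
        IsAlgebraic (↥(IntermediateField.adjoin ℚ ({(2 * ↑Real.pi * Complex.I : ℂ), u} : Set ℂ)))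
            (Complex.exp u) →
          u ∈ Submodule.span ℚ ({(2 * ↑Real.pi * Complex.I : ℂ)} : Set ℂ)) →
      ∀ u : ℂ, Complex.exp u = ↑Real.pi → u ∉ logFreeCore := by
  intro hHL u hlog
  exact LogPiCoreHL.logPi_not_mem_core_of_coreHL hHL hlog

end Summit.Schanuel.Schanuel.Theorems.RigidCore

end
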